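import Literature.AlgebraicGeometry.Frobenioids.BiratUnitsAut
import Literature.AlgebraicGeometry.Frobenioids.BirationalizationRigidity
import Literature.AlgebraicGeometry.Frobenioids.BiratGerms
import Literature.AlgebraicGeometry.Frobenioids.CoAngular
import HarnessLib

/-!
# Frobenioids I, Theorem 5.2 (iv), proof step: the unit factor of a base-identity birational endomorphism along a Frobenius-type endomorphism

Mochizuki, *The geometry of Frobenioids I: the general theory*, Kyushu J. Math. **62** (2008)
293–400, §5, proof of Theorem 5.2 (iv), kurims text p. 102 [cite: MochizukiFrdI2008, Thm. 5.2(iv) p.102]: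
"we may apply Remark 2.7.2 to `E` to conclude that every morphism `ψ` of `E` admits a unique
factorization `ψ = ψ_P ∘ ψ_{O^×} ∘ ψ_F` … where … `ψ_{O^×}` is a base-identity automorphism;
`ψ_F` is `F`-distinguished" — the `O^×`-part is the fourth entry of the comparison functor.

The `F`/`O^×` half of that factorisation, proved DIRECTLY from the axioms of `C` (Def. 1.3 (ii),
(iv)(a), Prop. 1.4 (iii)) for a Frobenioid of isotropic type — no Frobenioid structure on `C^birat` is
used: if `γ : A → A` is a base-identity endomorphism (e.g. of Frobenius type) and `ψ₀ = [(β₀, χ₀)]` is a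
base-identity birational endomorphism of `A` of the same Frobenius degree, then `ψ₀ = γ^birat ∘ u`
in `C^birat` for a rational function `u ∈ O^×(A^birat)`, unique (`γ^birat` is an epimorphism — seat
L1-t10's `Birat.epi_toBirat_map` — and `O^×(A^birat) → Aut(A^birat)` is injective).  Construction:
factor `χ₀ = γ' ≫ β''` and `β₀ ≫ γ = γ₂ ≫ β₂` into Frobenius-type ∘ pre-step (Def. 1.3 (iv)(a), the
pull-back factor being an isomorphism for base-isomorphisms, Prop. 1.4 (iii)); by Def. 1.3 (ii)
`γ₂ = γ' ≫ i`; then `u := [(i ≫ β₂, β'')]`.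
-/

namespace Literature.AlgebraicGeometry.Frobenioids

open CategoryTheory Opposite

universe w v v' u u'

namespace PreFrobenioid

variable {D : Type u} [Category.{v} D] {Φ : Dᵒᵖ ⥤ CommMonCat.{w}}
  {C : Type u'} [Category.{v'} C] {F : C ⥤ ElemFrobenioid Φ} {hF : IsFrobenioid F}
  {hsq : HasBiratSquares F}

/-- Def. 1.3 (iv)(a) for a BASE-ISOMORPHISM `χ`: `χ = γ' ≫ β''` with `γ'` of Frobenius type and `β''` a
pre-step (the pull-back factor is an LB-invertible pre-step, hence an isomorphism, Prop. 1.4 (iii)),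
and `deg_Fr γ' = deg_Fr χ`. [cite: MochizukiFrdI2008, Def. 1.3(iv)] -/
theorem exists_frobeniusType_preStep_factorisation (hF : IsFrobenioid F) {W A : C} (χ : W ⟶ A)
    (hχ : IsBaseIso F χ) :
    ∃ (X : C) (γ' : W ⟶ X) (β'' : X ⟶ A), γ' ≫ β'' = χ ∧ IsFrobeniusType F γ' ∧ IsPreStep F β'' ∧
      degFr F γ' = degFr F χ := by
  obtain ⟨X, Y, γ', β', α', hfac, hγ', hβ', hα'⟩ := hF.iv_a_exists χ
  have hαlin : IsLinear F α' := (hF.iv_b α' hα').2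
  -- `α'` is a base-isomorphism: `Base χ = Base γ' ≫ Base β' ≫ Base α'` with the first two invertible
  have hαbi : IsBaseIso F α' := by
    haveI : IsIso (Base F γ') := hγ'.2
    haveI : IsIso (Base F β') := hβ'.2
    haveI : IsIso (Base F χ) := hχ
    have h : Base F α' = inv (Base F β') ≫ inv (Base F γ') ≫ Base F χ := by
      rw [← hfac, base_comp, base_comp, IsIso.inv_hom_id_assoc, IsIso.inv_hom_id_assoc]
    change IsIso (Base F α')
    rw [h]
    infer_instance
  haveI : IsIso α' := isIso_of_isLBInvertible_of_isPreStep F hF α' (hF.iv_b α' hα').1 ⟨hαlin, hαbi⟩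
  refine ⟨X, γ', β' ≫ α', by rw [hfac], hγ', IsPreStep.comp F hβ' ⟨hαlin, hαbi⟩, ?_⟩
  have hdeg := congrArg (degFr F) hfac
  rw [degFr_comp, degFr_comp, hβ'.1, hαlin, mul_one, mul_one] at hdeg
  exact hdeg

namespace BiratUnits

/-- **The unit factor** (existence): for a base-identity endomorphism `γ : A → A` (e.g. an
`F`-distinguished one, of Frobenius type) and a base-identity birational endomorphism `[(β₀, χ₀)]` of `A`
with `deg_Fr χ₀ = deg_Fr γ`, there is `u ∈ O^×(A^birat)` with `γ^birat ≫ u = [(β₀, χ₀)]` in `C^birat`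
(isotropic type; the Frobenius type of `γ` is not even needed).
[cite: MochizukiFrdI2008, Thm. 5.2(iv) p.102] -/
theorem exists_unit_factor (hiso : IsOfIsotropicType F) {A W : C} (β₀ χ₀ : W ⟶ A)
    (hβ₀ : IsCoAngularPreStep F β₀) (hb : Base F χ₀ = Base F β₀) (γ : A ⟶ A)
    (hγb : IsBaseIdentity F γ) (hdeg : degFr F χ₀ = degFr F γ) :
    ∃ u : BiratUnits F hF A, (toBirat F hF hsq).map γ ≫ toHom hsq u =
      Birat.homMk (X := (toBirat F hF hsq).obj A) (Y := (toBirat F hF hsq).obj A) ⟨W, β₀, χ₀, hβ₀⟩ := by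
  haveI : IsIso (Base F β₀) := hβ₀.2.2
  have hχbi : IsBaseIso F χ₀ := by
    change IsIso (Base F χ₀)
    rw [hb]
    infer_instance
  -- `χ₀ = γ' ≫ β''`
  obtain ⟨X, γ', β'', hfac₁, hγ', hβ'', hdeg₁⟩ :=
    exists_frobeniusType_preStep_factorisation hF χ₀ hχbi
  -- `β₀ ≫ γ = γ₂ ≫ β₂`
  have hbg : IsBaseIso F (β₀ ≫ γ) := by
    change IsIso (Base F (β₀ ≫ γ))
    rw [base_comp, hγb, Category.comp_id]
    infer_instance
  obtain ⟨X₂, γ₂, β₂, hfac₂, hγ₂, hβ₂, hdeg₂⟩ :=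
    exists_frobeniusType_preStep_factorisation hF (β₀ ≫ γ) hbg
  -- Def. 1.3 (ii): `γ₂ = γ' ≫ i`
  have hdd : degFr F γ' = degFr F γ₂ := by
    rw [hdeg₁, hdeg₂, degFr_comp, hβ₀.2.1, one_mul, hdeg]
  obtain ⟨i, hi⟩ := hF.ii_unique γ' γ₂ hγ' hγ₂ hdd
  -- the unit `u := [(i ≫ β₂, β'')]`
  have hden : IsCoAngularPreStep F (i.hom ≫ β₂) :=
    isCoAngularPreStep_of_isotropic hiso (IsPreStep.comp F (isPreStep_of_isIso F i.hom) hβ₂)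
  have hnum : IsCoAngularPreStep F β'' := isCoAngularPreStep_of_isotropic hiso hβ''
  have hbase : Base F (i.hom ≫ β₂) = Base F β'' := by
    haveI : IsIso (Base F γ') := hγ'.2
    have h1 : Base F γ' ≫ Base F (i.hom ≫ β₂) = Base F β₀ := by
      rw [← base_comp, ← Category.assoc, hi, hfac₂, base_comp, hγb, Category.comp_id]
    have h2 : Base F γ' ≫ Base F β'' = Base F β₀ := by
      rw [← base_comp, hfac₁, hb]
    exact (cancel_epi (Base F γ')).mp (h1.trans h2.symm)
  let q : RatFrac F A := ⟨X, i.hom ≫ β₂, β'', hden, hnum, hbase⟩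
  refine ⟨mk hF q, ?_⟩
  rw [toHom_mk, toBirat_map]
  let S : BiratFrac.Square (BiratFrac.ofHom hF γ) q.toBiratFrac :=
    { apex := W, left := β₀, right := γ', left_mem := hβ₀
      w := by
        change β₀ ≫ γ = γ' ≫ (i.hom ≫ β₂)
        rw [← Category.assoc, hi, hfac₂] }
  refine (Birat.homMk_comp_homMk_eq (X := (toBirat F hF hsq).obj A) (Y := (toBirat F hF hsq).obj A)
    (Z := (toBirat F hF hsq).obj A) _ _ S).trans (Birat.homMk_sound ?_)
  refine ⟨W, 𝟙 W, 𝟙 W, isCoAngularPreStep_id hF W, isCoAngularPreStep_id hF W, ?_, ?_⟩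
  · change 𝟙 W ≫ β₀ ≫ 𝟙 A = 𝟙 W ≫ β₀
    rw [Category.comp_id]
  · change 𝟙 W ≫ γ' ≫ β'' = 𝟙 W ≫ χ₀
    rw [hfac₁]

/-- **The unit factor is unique**: `γ^birat` is an epimorphism of `C^birat` (seat L1-t10) and
`O^×(A^birat) → End(A^birat)` is injective. [cite: MochizukiFrdI2008, Thm. 5.2(iv) p.102] -/
theorem unit_factor_unique {A : C} (γ : A ⟶ A) {u u' : BiratUnits F hF A}
    (h : (toBirat F hF hsq).map γ ≫ toHom hsq u = (toBirat F hF hsq).map γ ≫ toHom hsq u') :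
    u = u' := by
  haveI := Birat.epi_toBirat_map hF hsq γ
  exact toHom_injective ((cancel_epi _).mp h)

end BiratUnits

end PreFrobenioid

end Literature.AlgebraicGeometry.Frobenioids
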